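import Summits.AtomisticToContinuum.HydrodynamicLimit.Theses.AntiMazurCoboundaries
import Summits.AtomisticToContinuum.HydrodynamicLimit.Theses.FluxGibbsianityLdDrude
import Summits.AtomisticToContinuum.HydrodynamicLimit.Theorems.AntiMazurCoboundariesKineticFluxLdDecayObjects
import HarnessLib

/-!
# Skeleton — crux `KineticFluxLdDecay` (stmt-AtomisticToContinuum-10967), line `coarse-doob-corrector`

Crux-strategist (wall-breaker) `planner-cstrat-stmt-AtomisticToContinuum-10967-p1-0`, 2026-08-17.
Line card: `Cruxes/KineticFluxLdDecay/Lines/coarse_doob_corrector.md`.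

THE CUT. Write the crux's window average over a window of `m` ROUNDS of length `Δ = d ℓ_N`
(`τ = m d`) as `(1/m) Σ_{k<m} R∘Φ_{kΔ}`, `R = Σ_i η_i` the per-particle round gains. Subtract from each
particle's gain its LOCAL-EQUILIBRIUM value `φ(x_i) Γ_g(û_c, θ̂_c)` at the EMPIRICAL drift/temperature
of its mesoscopic cell (side `Λ ℓ_N`): `η_i = η_i^f + φ(x_i)Γ_g(…)`. The slow part is priced STATICALLY
(Jensen in time + invariance + one equal-time Gibbs bound, stub S1). The fast part `S = Σ_k X^f_k` is
split by the Doob–Gordin decomposition along the COARSE ROUND FILTRATION `𝓕_k` generated by each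
particle's cell label, velocity bin and BINNED previous-round fast gain: `S = M_0 + Σ_k (M_{k+1} - M_k)`,
`M_k = E_G[S | 𝓕_k]`. Two dynamical inputs, neither of which is the crux reworded:

* S2 `stub_cellConditionedRelaxation` — FIRST MOMENT: the equilibrium forecast `M_0 = E_G[S | 𝓕_0]`
  of the whole future fast sum given the coarse INITIAL datum (cells + velocity bins at time 0) is
  `≤ C_D κ (N+1)` off an exponentially rare set of initial data, UNIFORMLY in the horizon `m`
  (bounded conditional corrector = integrated relaxation in the mean of coarse-cell-conditioned
  equilibrium; a Lanford-type initial class, an infinite horizon, but only the MEAN);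
* S3 `stub_conditionalRevisions` — CLT-SCALE CONDITIONAL CONCENTRATION: one round of revealed coarse
  data revises the forecast of the fast window sum sub-Gaussianly with an EXTENSIVE (∝ N+1, not
  ∝ (N+1)²) variance proxy, given ANY non-exceptional coarse history, up to a predictable non-negative
  allowance `Ξ_k` that is summable along good histories (pre-existing "energy bombs");

and a provable dock S4 (`exp`-supermartingale peeling = Azuma with predictable allowance, convexity,
invariance of `G_N`, the statics S1, binning): S1 → S2 → S3 → `RoundWindowDecay` (= the crux at the
windows `τ = m d`, `m ≥ m₀(δ)`), whence the crux BY NAME (`KineticFluxLdDecay_of`, choice `τ := m₀ d`).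

Why this is not the death of `dynkin-azuma-collision-innovations` (S6 ⟺ clamped crux): there the
filtration was the per-collision causal record, along which Azuma is FREE (increments `O(ℓ_N)`), so the
compensator carried the whole crux; along the trivial filtration the compensator is free and the
martingale is the crux. The ROUND filtration sits strictly between: its increments are extensive (S3 is
a genuine LD statement at CLT scale, one round of information at a time) and its compensator is needed
only at `k = 0` and only in the mean (S2). Neither S2 nor S3 is implied by the crux (S2: horizon-uniform
bound vs the crux's `m·(entropy + δ)`; S3: uniform over coarse pasts) and neither implies it alone.

Registered stubs (sorries ONLY here): `stub_slowSectorStatics` (S1), `stub_cellConditionedRelaxation`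
(S2), `stub_conditionalRevisions` (S3), `stub_dock` (S4). Objects: § 1. Composition: § 3 (sorry-free).
-/

noncomputable section

open MeasureTheory ProbabilityTheory Set Filter
open scoped ENNReal BigOperators Classical

namespace Summit.AtomisticToContinuum.HydrodynamicLimit.Cruxes.KineticFluxLdDecay.CoarseDoob

open Literature.MathematicalPhysics.KineticTheory (T3 V3 hsDiameter localGibbsLaw)
open Literature.Analysis.FluidPDE (HardSphereFlow Config)
open Summit.AtomisticToContinuum.HydrodynamicLimit.Theorems.DynkinAzuma
  (Flow Phase gibbs ell window sv obsA bin binVal binVec)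

/-! ## § 1 Objects of the line -/

/-- Admissible observable data at amplitude `b`: `φ` continuous with `|φ| ≤ 1`, `g` continuous with
`|g| ≤ b` and `g ⊥ span{1, v, |v|²}` in `L²(stdGaussian)` (the crux's clauses, verbatim). -/
def Adm (b : ℝ) (φ : T3 → ℝ) (g : V3 → ℝ) : Prop :=
  Continuous φ ∧ Continuous g ∧ (∀ x, |φ x| ≤ 1) ∧ (∀ v, |g v| ≤ b) ∧
    ∀ (c₀ c₂ : ℝ) (e : V3), ∫ v, g v * (c₀ + inner ℝ e v + c₂ * ‖v‖ ^ 2) ∂(stdGaussian V3) = 0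

/-- The parameter regime of the coarse apparatus: cell side `Λ ℓ_N` with `Λ ≥ 1`, velocity-bin mesh
`δv ∈ (0,1]` (thermal units), gain-bin mesh `δg ∈ (0,1]`, round length `Δ = d ℓ_N` with
`d √θ ∈ [1/2, 1]` (a round moves a thermal particle by `ℓ_N/2 … ℓ_N ≫ σ ℓ_N`: the coarse history never
pins an impact parameter, and `Δ ≪` mean free time `ℓ_N/(4√π σ² √θ)` for small `σ`). -/
def ParamsOK (θ Λ δv δg d : ℝ) : Prop :=
  1 ≤ Λ ∧ 0 < δv ∧ δv ≤ 1 ∧ 0 < δg ∧ δg ≤ 1 ∧ 1 / 2 ≤ d * Real.sqrt θ ∧ d * Real.sqrt θ ≤ 1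

/-- The round gain of particle `i`: `η_i(z) = Δ⁻¹ ∫₀^Δ φ(x_i(s)) g(w_i(s)) ds`, `Δ = window d N = d ℓ_N`
(guarded by the good set of the flow: junk `0` off `Φ.good`, a `G_N`-null set). -/
def gain (θ : ℝ) (u₀ : V3) (φ : T3 → ℝ) (g : V3 → ℝ) (d : ℝ) {σ : ℝ} {N : ℕ} (Φ : Flow σ N)
    (i : Fin (N + 1)) (z : Phase N) : ℝ :=
  if z ∈ Φ.good then
    (window d N)⁻¹ * ∫ s in (0 : ℝ)..window d N, φ (Φ.flow s z i).1 * g (sv θ u₀ (Φ.flow s z i).2)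
  else 0

/-- The mesoscopic cell label of particle `i` (cells of side `Λ ℓ_N` on `𝕋³`). -/
def cellOf (Λ : ℝ) {N : ℕ} (z : Phase N) (i : Fin (N + 1)) : Fin 3 → ℤ :=
  Literature.Analysis.FluidPDE.Torus.coarseCell (Λ * ell N) (z i).1

/-- The particles sharing particle `i`'s cell (contains `i`). -/
def cellMates (Λ : ℝ) {N : ℕ} (z : Phase N) (i : Fin (N + 1)) : Finset (Fin (N + 1)) :=
  Finset.univ.filter fun j => cellOf Λ z j = cellOf Λ z i

/-- Empirical scaled drift of particle `i`'s cell: `û = n_c⁻¹ Σ_{j ∈ cell} w_j`. -/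
def cellDrift (θ : ℝ) (u₀ : V3) (Λ : ℝ) {N : ℕ} (z : Phase N) (i : Fin (N + 1)) : V3 :=
  ((cellMates Λ z i).card : ℝ)⁻¹ • ∑ j ∈ cellMates Λ z i, sv θ u₀ (z j).2

/-- Empirical scaled temperature of particle `i`'s cell: `θ̂ = (3 n_c)⁻¹ Σ_{j ∈ cell} ‖w_j - û‖²`. -/
def cellTemp (θ : ℝ) (u₀ : V3) (Λ : ℝ) {N : ℕ} (z : Phase N) (i : Fin (N + 1)) : ℝ :=
  (3 * ((cellMates Λ z i).card : ℝ))⁻¹ * ∑ j ∈ cellMates Λ z i, ‖sv θ u₀ (z j).2 - cellDrift θ u₀ Λ z i‖ ^ 2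

/-- The local-equilibrium value of the velocity test `g` at scaled drift `u` and scaled temperature `t`:
`Γ_g(u,t) = ∫ g(√t w + u) dγ(w)`. For `g ⊥ {1, v, |v|²}` it vanishes to SECOND order at `(0,1)`. -/
def leValue (g : V3 → ℝ) (u : V3) (t : ℝ) : ℝ :=
  ∫ w, g (Real.sqrt t • w + u) ∂(stdGaussian V3)

/-- The slow (local-equilibrium) part of particle `i`'s gain: `φ(x_i) Γ_g(û_{c(i)}, θ̂_{c(i)})`
(equal-time object: positions and velocities at the start of the round). -/
def slowGainOf (θ : ℝ) (u₀ : V3) (φ : T3 → ℝ) (g : V3 → ℝ) (Λ : ℝ) {N : ℕ} (z : Phase N)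
    (i : Fin (N + 1)) : ℝ :=
  φ (z i).1 * leValue g (cellDrift θ u₀ Λ z i) (cellTemp θ u₀ Λ z i)

/-- The slow gain `X_s = Σ_i φ(x_i) Γ_g(û_{c(i)}, θ̂_{c(i)})`. -/
def slowGain (θ : ℝ) (u₀ : V3) (φ : T3 → ℝ) (g : V3 → ℝ) (Λ : ℝ) {N : ℕ} (z : Phase N) : ℝ :=
  ∑ i, slowGainOf θ u₀ φ g Λ z i

/-- The fast part of particle `i`'s round gain: `η^f_i = η_i - φ(x_i) Γ_g(û_{c(i)}, θ̂_{c(i)})`. -/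
def fastGainOf (θ : ℝ) (u₀ : V3) (φ : T3 → ℝ) (g : V3 → ℝ) (Λ d : ℝ) {σ : ℝ} {N : ℕ} (Φ : Flow σ N)
    (z : Phase N) (i : Fin (N + 1)) : ℝ :=
  gain θ u₀ φ g d Φ i z - slowGainOf θ u₀ φ g Λ z i

/-- The BINNED fast gain `X^b_f = Σ_i δg ⌊η^f_i / δg⌋` (within `(N+1) δg` of `Σ_i η^f_i`). -/
def fastGainBin (θ : ℝ) (u₀ : V3) (φ : T3 → ℝ) (g : V3 → ℝ) (Λ δg d : ℝ) {σ : ℝ} {N : ℕ}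
    (Φ : Flow σ N) (z : Phase N) : ℝ :=
  ∑ i, binVal δg (fastGainOf θ u₀ φ g Λ d Φ z i)

/-- The coarse datum of particle `i` at the START of round `k` (a function of the initial condition
`z` through the flow): its cell label, its velocity bin, and the bin label of its fast gain over the
PREVIOUS round (`0` for `k = 0`). Countable codomain. -/
def datum (θ : ℝ) (u₀ : V3) (φ : T3 → ℝ) (g : V3 → ℝ) (Λ δv δg d : ℝ) {σ : ℝ} {N : ℕ}
    (Φ : Flow σ N) (k : ℕ) (z : Phase N) : Fin (N + 1) → (Fin 3 → ℤ) × (Fin 3 → ℤ) × ℤ :=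
  fun i =>
    (cellOf Λ (Φ.flow (k * window d N) z) i,
     binVec δv (sv θ u₀ ((Φ.flow (k * window d N) z) i).2),
     if k = 0 then 0
     else bin δg (fastGainOf θ u₀ φ g Λ d Φ (Φ.flow ((k - 1 : ℕ) * window d N) z) i))

/-- The coarse HISTORY σ-algebra `𝓕_k`: generated by the data of rounds `0, …, k`, intersected with the
Borel σ-algebra of phase space (so that `𝓕_k ≤` Borel holds by construction and the conditional
expectations below are never Mathlib's junk `0`). `𝓕_0` = cells and velocity bins at time `0`. -/
@[reducible] def histSigma (θ : ℝ) (u₀ : V3) (φ : T3 → ℝ) (g : V3 → ℝ) (Λ δv δg d : ℝ) {σ : ℝ} {N : ℕ}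
    (Φ : Flow σ N) (k : ℕ) : MeasurableSpace (Phase N) :=
  (⨆ j ∈ Finset.range (k + 1),
      MeasurableSpace.comap (datum θ u₀ φ g Λ δv δg d Φ j) inferInstance) ⊓ inferInstance

/-- The centred binned fast window sum over `m` rounds,
`S^b_m(z) = Σ_{k<m} (X^b_f(Φ_{kΔ} z) - E_{G_N} X^b_f)`. -/
def fastWindowSum (a θ : ℝ) (u₀ : V3) (φ : T3 → ℝ) (g : V3 → ℝ) (Λ δg d : ℝ) {σ : ℝ} {N : ℕ}
    (Φ : Flow σ N) (m : ℕ) (z : Phase N) : ℝ :=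
  ∑ k ∈ Finset.range m,
    (fastGainBin θ u₀ φ g Λ δg d Φ (Φ.flow (k * window d N) z) -
      ∫ z', fastGainBin θ u₀ φ g Λ δg d Φ z' ∂(gibbs σ a θ u₀ N Φ))

/-- The Doob martingale of the fast window sum along the coarse history filtration:
`M_j = E_{G_N}[S^b_m | 𝓕_j]` (`M_m = S^b_m` a.e.: the binned fast gains of rounds `< m` are `𝓕_m`-data;
`M_0` = the forecast given the initial cells and velocity bins). -/
def doob (a θ : ℝ) (u₀ : V3) (φ : T3 → ℝ) (g : V3 → ℝ) (Λ δv δg d : ℝ) {σ : ℝ} {N : ℕ}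
    (Φ : Flow σ N) (m j : ℕ) : Phase N → ℝ :=
  condExp (histSigma θ u₀ φ g Λ δv δg d Φ j) (gibbs σ a θ u₀ N Φ) (fastWindowSum a θ u₀ φ g Λ δg d Φ m)

/-! ## § 2 Statements of the line -/

/-- S1 statement · SLOW-SECTOR STATICS (equal-time, provable-grade): the local-equilibrium part
`X_s = Σ_i φ(x_i) Γ_g(û_{c(i)}, θ̂_{c(i)})` is a sum over `≍ (N+1)/Λ³` cells of cell functionals that
are `O(b)`-sub-exponential and, given the positions, independent across cells (velocities are i.i.d.
Gaussian under `G_N`, independent of the hard-core positions); `Γ_g` vanishes to second order at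
`(û, θ̂) = (0, 1)` by the three orthogonality clauses. Hence a sub-Gaussian bound with variance proxy
`∝ b² (N+1)/Λ³` for `|λ| b ≤ c₀`, the constants `C, c₀` depending on `σ` only (`N₀` may depend on
`Λ`: for `Λ³ ≫ N` one cell holds everything and `X_s` is an `O(b)` non-degenerate variable). -/
def SlowSectorStatics : Prop :=
  ∀ (a θ : ℝ) (u₀ : V3), 0 < a → 0 < θ → ∃ σ₀ : ℝ, 0 < σ₀ ∧ ∀ σ : ℝ, 0 < σ → σ < σ₀ →
    ∃ C : ℝ, 0 ≤ C ∧ ∃ c₀ : ℝ, 0 < c₀ ∧ ∀ Λ : ℝ, 1 ≤ Λ → ∀ (b : ℝ) (φ : T3 → ℝ) (g : V3 → ℝ), 0 < b → Adm b φ g →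
      ∃ N₀ : ℕ, ∀ N : ℕ, N₀ ≤ N → ∀ (Φ : Flow σ N) (lam : ℝ), |lam| * b ≤ c₀ →
        ∫ z, Real.exp (lam * (slowGain θ u₀ φ g Λ z - ∫ z', slowGain θ u₀ φ g Λ z' ∂(gibbs σ a θ u₀ N Φ)))
            ∂(gibbs σ a θ u₀ N Φ) ≤
          Real.exp (C * lam ^ 2 * b ^ 2 * ((N : ℝ) + 1) / Λ ^ 3)

/-- S2 statement · CELL-CONDITIONED INTEGRATED RELAXATION IN THE MEAN (dynamical input 1, first
moment): for all apparatus parameters in the regime and every admissible `(φ, g)` at amplitude `b`, the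
equilibrium forecast of the centred binned fast window sum given the INITIAL coarse datum
(`𝓕_0` = cells and velocity bins at time `0`) is bounded by `C_D b (N+1)` UNIFORMLY IN THE HORIZON `m`,
off an `𝓕_0`-measurable exceptional set of `G_N`-mass `≤ e^{-C_*(N+1)}` (`C_*` depends on `σ` only; the
dock pays for the exceptional set with the amplitude, `κ ≤ C_*/32`). Content: a coarse-cell-conditioned
equilibrium law of specific entropy `≤ C_*` carries a bounded entropy budget, and every fast one-body
velocity structure it can encode either relaxes within `O(1)` mean free times or costs entropy
proportional to its lifetime (collision avoidance ∝ rate·time; structured collisions ∝ #·log(1/σ)), so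
its INTEGRATED future fast bias is `O(budget)`; second-order hydrodynamic bias is removed by the
cell-scale local-equilibrium subtraction. False for `σ = 0` and `d = 1` rods (velocity law conserved). -/
def CellConditionedRelaxation : Prop :=
  ∀ (a θ : ℝ) (u₀ : V3), 0 < a → 0 < θ → ∃ σ₀ : ℝ, 0 < σ₀ ∧ ∀ σ : ℝ, 0 < σ → σ < σ₀ →
    ∃ Cstar : ℝ, 0 < Cstar ∧ ∀ (Λ δv δg d : ℝ), ParamsOK θ Λ δv δg d →
      ∀ (b : ℝ) (φ : T3 → ℝ) (g : V3 → ℝ), 0 < b → Adm b φ g →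
        ∃ C_D : ℝ, 0 ≤ C_D ∧ ∃ N₀ : ℕ, ∀ N : ℕ, N₀ ≤ N → ∀ (Φ : Flow σ N) (m : ℕ),
          ∃ B : Set (Phase N),
            MeasurableSet[histSigma θ u₀ φ g Λ δv δg d Φ 0] B ∧
            gibbs σ a θ u₀ N Φ B ≤ ENNReal.ofReal (Real.exp (-(Cstar * ((N : ℝ) + 1)))) ∧
            ∀ᵐ z ∂(gibbs σ a θ u₀ N Φ), z ∉ B →
              |doob a θ u₀ φ g Λ δv δg d Φ m 0 z| ≤ C_D * b * ((N : ℝ) + 1)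

/-- S3 statement · CONDITIONAL SUB-GAUSSIAN REVISIONS WITH A SUMMABLE PREDICTABLE ALLOWANCE
(dynamical input 2, CLT-scale LD, one round of information at a time): along the coarse history
filtration the Doob martingale `M_k = E_G[S^b_m | 𝓕_k]` of the centred binned fast window sum has, for
`|λ| ≤ λ₀` and off `𝓕_k`-measurable exceptional sets of mass `≤ e^{-C_*(N+1)}`,
`E_G[exp(λ (M_{k+1} - M_k)) | 𝓕_k] ≤ exp(V λ² b² (N+1)/2 + |λ| Ξ_k)` with `Ξ_k ≥ 0` `𝓕_k`-measurable and
`Σ_{k<m} Ξ_k ≤ C_Ξ b (N+1)` along good histories; `V, C_Ξ, λ₀` independent of `m` and `N`. Content: one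
round of revealed coarse data (cells, bins, binned fast gains) is a sum over particles of local
innovations — the variance proxy is EXTENSIVE, not quadratic in `N` (Hoeffding's range bound is useless)
—, anti-relaxing fluctuation histories are absorbed in `V` (their continuation is exponentially rare at
exactly the Gaussian exchange rate), and pre-existing "energy bombs" (a particle of extensive energy
whose cascade location is decided in `O(1)` rounds) are the reason for the predictable allowance `Ξ`.
Kill: a hidden quasi-local charge, or conspiracy amplification of one round's information. -/
def ConditionalRevisions : Prop :=
  ∀ (a θ : ℝ) (u₀ : V3), 0 < a → 0 < θ → ∃ σ₀ : ℝ, 0 < σ₀ ∧ ∀ σ : ℝ, 0 < σ → σ < σ₀ →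
    ∃ Cstar : ℝ, 0 < Cstar ∧ ∀ (Λ δv δg d : ℝ), ParamsOK θ Λ δv δg d →
      ∀ (b : ℝ) (φ : T3 → ℝ) (g : V3 → ℝ), 0 < b → Adm b φ g →
        ∃ V : ℝ, 0 ≤ V ∧ ∃ C_Ξ : ℝ, 0 ≤ C_Ξ ∧ ∃ lam₀ : ℝ, 0 < lam₀ ∧ ∃ N₀ : ℕ, ∀ N : ℕ, N₀ ≤ N →
          ∀ (Φ : Flow σ N) (m : ℕ),
            ∃ (B : ℕ → Set (Phase N)) (Ξ : ℕ → Phase N → ℝ),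
              (∀ k, MeasurableSet[histSigma θ u₀ φ g Λ δv δg d Φ k] (B k)) ∧
              (∀ k, gibbs σ a θ u₀ N Φ (B k) ≤ ENNReal.ofReal (Real.exp (-(Cstar * ((N : ℝ) + 1))))) ∧
              (∀ k, Measurable[histSigma θ u₀ φ g Λ δv δg d Φ k] (Ξ k)) ∧
              (∀ k z, 0 ≤ Ξ k z) ∧
              (∀ᵐ z ∂(gibbs σ a θ u₀ N Φ), (∀ k, k < m → z ∉ B k) →
                ∑ k ∈ Finset.range m, Ξ k z ≤ C_Ξ * b * ((N : ℝ) + 1)) ∧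
              ∀ lam : ℝ, |lam| ≤ lam₀ → ∀ k : ℕ, k < m →
                ∀ᵐ z ∂(gibbs σ a θ u₀ N Φ), z ∉ B k →
                  condExp (histSigma θ u₀ φ g Λ δv δg d Φ k) (gibbs σ a θ u₀ N Φ)
                      (fun z => Real.exp (lam *
                        (doob a θ u₀ φ g Λ δv δg d Φ m (k + 1) z - doob a θ u₀ φ g Λ δv δg d Φ m k z))) z ≤
                    Real.exp (V * lam ^ 2 * b ^ 2 * ((N : ℝ) + 1) / 2 + |lam| * Ξ k z)

/-- The target of the dock: the crux at the windows `τ = m·d`, `m ≥ m₀(δ)` (same frame, same prefix,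
same amplitude quantifier as `KineticFluxLdDecay`; `obsA θ u₀ φ g τ Φ z` is the crux's integrand). -/
def RoundWindowDecay : Prop :=
  ∀ (a θ : ℝ) (u₀ : V3), 0 < a → 0 < θ → ∃ σ₀ : ℝ, 0 < σ₀ ∧ ∀ σ : ℝ, 0 < σ → σ < σ₀ →
    (∀ (N : ℕ) (Φ : Flow σ N), IsProbabilityMeasure (gibbs σ a θ u₀ N Φ)) ∧
    ∃ κ : ℝ, 0 < κ ∧ ∃ d : ℝ, 0 < d ∧
      ∀ (φ : T3 → ℝ) (g : V3 → ℝ), Continuous φ → Continuous g → (∀ x, |φ x| ≤ 1) →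
        (∀ v, |g v| ≤ κ) →
        (∀ (c₀ c₂ : ℝ) (e : V3), ∫ v, g v * (c₀ + inner ℝ e v + c₂ * ‖v‖ ^ 2) ∂(stdGaussian V3) = 0) →
        ∀ δ : ℝ, 0 < δ → ∃ m₀ : ℕ, 1 ≤ m₀ ∧ ∀ m : ℕ, m₀ ≤ m → ∃ N₀ : ℕ, ∀ N : ℕ, N₀ ≤ N →
          ∀ Φ : Flow σ N,
            ∫⁻ z, ENNReal.ofReal (Real.exp (obsA θ u₀ φ g ((m : ℝ) * d) Φ z)) ∂(gibbs σ a θ u₀ N Φ) ≤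
              ENNReal.ofReal (Real.exp (δ * (N + 1)))

/-! ## Registered stubs -/

/-- **S1 · `stub_slowSectorStatics`** (equal-time statics; size L): conditional on the positions the
cell functionals are independent, each `O(b)`-sub-exponential (`Γ_g(u,t) ≤ C b min(1, |u|²+(t-1)²)` by
Gaussian smoothing and the three orthogonality clauses; `n_c|û_c|² ~ χ²₃`); the position-dependent
conditional means form a bounded local functional of the dilute hard-core Gibbs point process
(low-activity cluster expansion / Dobrushin concentration). -/
theorem stub_slowSectorStatics : SlowSectorStatics := by
  sorry

/-- **S2 · `stub_cellConditionedRelaxation`** (DYNAMICAL INPUT 1 — integrated Boltzmann relaxation IN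
THE MEAN, uniformly in `N`, from coarse-cell-conditioned equilibrium; open at fixed reduced density,
FIRST-MOMENT currency). -/
theorem stub_cellConditionedRelaxation : CellConditionedRelaxation := by
  sorry

/-- **S3 · `stub_conditionalRevisions`** (DYNAMICAL INPUT 2 — CLT-scale conditional concentration of
one-round Doob revisions given coarse histories, with a summable predictable allowance; the hardest
stub). -/
theorem stub_conditionalRevisions : ConditionalRevisions := by
  sorry

/-- **S4 · `stub_dock`** (provable now; size L in Lean): `exp(A) ≤ ½e^{(2/m)S_f} + ½e^{(2/m)S_s}`
(convexity); slow half by Jensen in `k`, invariance of `G_N` and S1 at `Λ(δ)`; fast half: binning error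
`≤ 2(N+1)δg` in sup norm, then the `exp`-supermartingale
`exp(λM_k - Σ_{i<k}(λ²Vb²(N+1)/2 + |λ|Ξ_i))` peeled along `𝓕_k` on the good histories (S3), the bottom
`E e^{λM_0}` by S2, bad histories by `κ ≤ C_*/32`; centring by `E_{G_N}F = 0` (one-site Gaussian
factorisation of `G_N`) and the exact orbit identity `obsA(m d) = m⁻¹Σ_k R∘Φ_{kΔ}` on the good set. -/
theorem stub_dock : SlowSectorStatics → CellConditionedRelaxation → ConditionalRevisions →
    RoundWindowDecay := by
  sorry

/-! ## § 3 Composition: the stubs imply the crux (kernel-checked; no `sorry` from here on) -/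

/-- **Composition** (route AntiMazurCoboundaries' copy of the crux, BY NAME): the dock at the
window `τ := m₀ d`. -/
theorem KineticFluxLdDecay_of :
    Summit.AtomisticToContinuum.HydrodynamicLimit.Theses.AntiMazurCoboundaries.KineticFluxLdDecay := by
  have hR : RoundWindowDecay :=
    stub_dock stub_slowSectorStatics stub_cellConditionedRelaxation stub_conditionalRevisions
  intro a θ u₀ ha hθ
  obtain ⟨σ₀, hσ₀, H⟩ := hR a θ u₀ ha hθ
  refine ⟨σ₀, hσ₀, fun σ hσ hσlt => ?_⟩
  obtain ⟨hprob, κ, hκ, d, hd, Hφ⟩ := H σ hσ hσlt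
  refine ⟨hprob, κ, hκ, fun φ g hφ hg hφ1 hgκ horth δ hδ => ?_⟩
  obtain ⟨m₀, hm₀, Hm⟩ := Hφ φ g hφ hg hφ1 hgκ horth δ hδ
  obtain ⟨N₀, HN⟩ := Hm m₀ le_rfl
  have hm₀pos : (0 : ℝ) < (m₀ : ℝ) := by exact_mod_cast Nat.lt_of_lt_of_le Nat.zero_lt_one hm₀
  exact ⟨(m₀ : ℝ) * d, mul_pos hm₀pos hd, N₀, fun N hN Φ => HN N hN Φ⟩

/-- **Composition** (route FluxGibbsianityLdDrude's copy of the crux, BY NAME; the two decls are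
syntactically identical). -/
theorem KineticFluxLdDecay_of' :
    Summit.AtomisticToContinuum.HydrodynamicLimit.Theses.FluxGibbsianityLdDrude.KineticFluxLdDecay :=
  KineticFluxLdDecay_of

end Summit.AtomisticToContinuum.HydrodynamicLimit.Cruxes.KineticFluxLdDecay.CoarseDoob

end
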